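import Summits.PneNP.PneNP.Theses.DirichletPigeons
import Literature.NumberTheory.DiophantineApproximation.SimultaneousApproxComplexityProofs
import Literature.Computability.Cryptography.OneWayFunctionsPneNP

/-!
# Route DirichletPigeons — `Assembly` (stmt-PneNP-10866)

`GsaMemNP → GsaPriceOfDimension → PneNP`. By contradiction: `¬ PneNP` gives `NP ⊆ P`
(`Literature.Computability.Cryptography.pneNP_shape_of_NP_not_subset_P`, through the proved model bridges
`P_bool_eq_holds` / `NP_bool_eq_holds`), so the GSA language is in `P`; `mem_P_iff_holds` yields a machine `M`
deciding it in time `p(L)`; on codewords the indicator of the language is any Boolean indicator of `Yes`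
(`encode_mem_gsaLang_iff`), and `T d L := p(L)` is `≤ c' · 2^{δ d} · (L+1)^{c'}` for every `δ ≥ 0`
(`exists_eval_le_mul_pow_add`, `c' = 2c + k`) — so GSA ∈ TIME(2^{δ d}·poly) for every `δ > 0`, contradicting
thesis X. The route's inline `gsaInExpTime δ` is definitionally the Literature form over
`SimultaneousApproxInstance.encoding` / `IsExpPolyBound` / `Complexity.ComputesInTime`.
-/

set_option linter.dupNamespace false -- `Summit.PneNP.PneNP.…`: summit = sub-problem name (D-0017 single-conjunct layout)

namespace Summit.PneNP.PneNP.Theorems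

open _root_.Computability
open Literature.Computability.Complexity Literature.NumberTheory.DiophantineApproximation

/-- If the GSA language is in `P` then, for every `δ ≥ 0` and every Boolean indicator `χ` of `Yes`, some machine
computes `χ` on every instance `I` within `T d L ≤ c' · 2^{δ d} · (L+1)^{c'}` steps, `L = |code of I|`
(take `T d L := p(L)` for the polynomial `p` of the decider; pattern of
`Literature.Computability.FineGrained.kSATInExpTime_of_P_eq_NP`). [cite: ImpagliazzoPaturiJCSS2001, §1] [folklore] -/
theorem dirichletPigeons_gsaInExpTime_of_mem_P (hP : gsaLang ∈ Classes.P) {δ : ℝ} (hδ : 0 ≤ δ)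
    (χ : SimultaneousApproxInstance → Bool) (hχ : ∀ I, χ I = true ↔ I.Yes) :
    ∃ T : ℕ → ℕ → ℕ, Literature.Computability.FineGrained.IsExpPolyBound δ T ∧
      ∃ M, ComputesInTime SimultaneousApproxInstance.encoding.encode encodeBool χ
        (fun I => T I.1.1 (SimultaneousApproxInstance.encoding.encode I).length) M := by
  obtain ⟨p, M, hM⟩ := mem_P_iff_holds.1 hP
  obtain ⟨c, k, hck⟩ := exists_eval_le_mul_pow_add p
  refine ⟨fun _ L => p.eval L, ⟨2 * c + k, fun n L => ?_⟩, M, fun I => ?_⟩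
  · have h1 : ((p.eval L : ℕ) : ℝ) ≤ c * (L : ℝ) ^ k + c := by exact_mod_cast hck L
    have h2 : (1 : ℝ) ≤ (2 : ℝ) ^ (δ * n) := Real.one_le_rpow one_le_two (by positivity)
    have hL1 : (1 : ℝ) ≤ (L : ℝ) + 1 := by linarith [(Nat.cast_nonneg L : (0 : ℝ) ≤ L)]
    have h3 : (L : ℝ) ^ k ≤ ((L : ℝ) + 1) ^ (2 * c + k) :=
      (pow_le_pow_left₀ (Nat.cast_nonneg L) (by linarith) k).trans (pow_le_pow_right₀ hL1 (by omega))
    have h4 : (1 : ℝ) ≤ ((L : ℝ) + 1) ^ (2 * c + k) := one_le_pow₀ hL1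
    have hc : (0 : ℝ) ≤ c := Nat.cast_nonneg c
    calc ((p.eval L : ℕ) : ℝ) ≤ c * (L : ℝ) ^ k + c := h1
      _ ≤ c * ((L : ℝ) + 1) ^ (2 * c + k) + c * ((L : ℝ) + 1) ^ (2 * c + k) := by
          gcongr
          simpa using mul_le_mul_of_nonneg_left h4 hc
      _ = (2 * c : ℝ) * 1 * ((L : ℝ) + 1) ^ (2 * c + k) := by ring
      _ ≤ ((2 * c + k : ℕ) : ℝ) * (2 : ℝ) ^ (δ * n) * ((L : ℝ) + 1) ^ (2 * c + k) := by
          gcongr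
          push_cast
          linarith [(Nat.cast_nonneg k : (0 : ℝ) ≤ k)]
  · have h := hM (SimultaneousApproxInstance.encoding.encode I)
    have hind : gsaLang.boolIndicator (SimultaneousApproxInstance.encoding.encode I) = χ I := by
      rw [Bool.eq_iff_iff, hχ, ← encode_mem_gsaLang_iff]
      exact (Set.mem_iff_boolIndicator _ _).symm
    rw [hind] at h
    exact h

/-- **Assembly of route DirichletPigeons (stmt-PneNP-10866)**: `GsaMemNP → GsaPriceOfDimension → PneNP`.
`¬ PneNP ⇒ NP ⊆ P ⇒ gsaLang ∈ P ⇒ GSA ∈ TIME(2^{δ d}·poly)` for every `δ > 0`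
(`dirichletPigeons_gsaInExpTime_of_mem_P`), contradicting the `δ` of thesis X. The model bridges enter through
`pneNP_shape_of_NP_not_subset_P` (proved), not as hypotheses. [cite: ImpagliazzoPaturiJCSS2001, §1] [cite: CookClay2006, §1] -/
theorem dirichletPigeons_assembly_proof : Summit.PneNP.PneNP.Theses.DirichletPigeons.Assembly := by
  intro hNP hX
  by_contra hne
  have hsub : Nondeterministic.NP ⊆ Classes.P := by
    by_contra h
    exact hne (Literature.Computability.Cryptography.pneNP_shape_of_NP_not_subset_P h)
  have hP : gsaLang ∈ Classes.P := hsub Lagarias.gsaLang_mem_NP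
  obtain ⟨δ, hδ, hnot⟩ := hX
  exact hnot (dirichletPigeons_gsaInExpTime_of_mem_P hP hδ.le _ fun I => @decide_eq_true_iff _ (_))

end Summit.PneNP.PneNP.Theorems
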